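import Mathlib
import HarnessLib
import Summits.ResolutionOfSingularities.ResolutionOfSingularities.Theorems.WildQuotientsWildQuotientResolutionS1KillExitDefs
import Literature.AlgebraicGeometry.Resolution.KiralyLutkebohmert

/-!
# Line L exit — (F1) global adapted frames: typed hypotheses and the real arrows available today

[OURS · L1 W4.5c · idea-1 g10/g11; plan-1 RULING (F1)/(γ′) SHAPE v1 2026-08-27T20:12:52Z; source memos
`L/res-L1-w45c-idea-1/f1/F1-SHAPE.md` 7379ae36e7c64e4c / `F1-SHAPE-v2.md` / `F1-SHAPE-v3.md`; v2 = v1.1 (tri-1 READ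
20:32:11Z PASS, tri-2 READ 20:25:37Z PASS + R-J) + §5 (F1-loc) typed on tri-1's posted signature
`reads19/F1LocSignature.lean` 09ac42f8c130e6af + §6 the REAL arrow `F1Loc p → F1LocExit p` (v2.1)] — NOT statements of
the manuscript; counted 0.
Crux stmt-ResolutionOfSingularities-17941 (`WildQuotients.CyclicQuotientFourfolds`), skeleton line
`s1a-logminvertex`, stub `stub_localGame`: the EXIT half of the producer owes ONE global boundary on the exit
zone of the quotient `Y = V/G` of the end model — the `S1.LogExitZone` clause of `S1.KillOrExitModel` (NOT the
consumer brick `S1.LogExitPatching`, which is Nizioł's theorem). HELPER MODULE, definition lane: named `Prop`s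
(NOT asserted) + the real implications provable over the tree today; no `sorry`. No group action is quantified
except through one ring automorphism `σ`.

What is here.
* §1 `logExitZone_of_isLogRegular` (REAL): an open zone `W ⊇ Z` (`Z` closed, `↑W` quasi-compact, `Y` regular off
  `Z`) that underlies a log regular scheme for a finite fs ZARISKI atlas (`Scheme.IsLogRegular ↑W`) is a log exit
  zone (`Scheme.IsLogRegular.isLogRegularEtale`). This is the door through which line L's frames enter: the
  (F1-glob′) frames are ALGEBRAIC global objects (`e = T⁻¹`, weighted strict transforms `f̄_b`, norms `N(x̄_a)`),
  so Zariski charts suffice (Kato's (2.1) for `𝒪_{Y,y}` descends from the completion); (F1-sep)/(F1-asm) are the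
  scheme bookkeeping that produces exactly this hypothesis (memo §3), not typed further here.
* §2 `CotIndep s` — independence modulo `𝔪²` of a finite family in a local ring (= linear independence of its
  image in the cotangent space `𝔪/𝔪²`; in a regular local ring: "part of a regular system of parameters"), with
  the two REAL lemmas carrying the pointwise half of (F1-glob′): `CotIndep.of_map` (independence seen through a
  local homomorphism into an overring `B` descends to `A`, e.g. Király–Lütkebohmert's `A = B^G ⊆ B`) and
  `CotIndep.perturb` (replacing each `x_b` by `f̄_b = x_b + g_b·e` keeps `(e, x_b, …)` independent).
* §3 weights: `WeightTame p w` (engine invariant (I-T): EMPIRICAL, an EXPLICIT binder wherever used — RULING (2)),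
  `HasFibralStratum w` / `PosPairwiseCoprime w` and the REAL criterion
  `hasFibralStratum_iff_not_posPairwiseCoprime`: a weighted move has a fibral (positive-dimensional) singular
  stratum on its exceptional divisor iff its positive weights are not pairwise coprime (census: 6/50 moves).
* §4 the (F1-glob′) hypothesis at ring level over `κ⟦x⟧ = MvPowerSeries (Fin n) κ`: `RaisesWeights σ w`
  (σ raises `w`-weights strictly — why σ extends to the extended Rees algebra fixing `T`),
  `InitialFormCompletable σ w b` (∃ a σ-invariant series with `w`-initial form `x_b`), `F1GlobHyp σ w` (every
  positive-weight coordinate of non-trivial `μ_ℓ`-character along every fibral `ℓ`-stratum is completable), and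
  the REAL discharges `initialFormCompletable_of_fixed` (an invariant coordinate is completable: the 6/6 fibral
  moves of the census) and `f1GlobHyp_of_posPairwiseCoprime` (vacuous without fibral strata: the other 44/50);
  then the folds of tri-1 Q2/Q3 and tri-2 Q1 (2026-08-27T20:16Z): `weightedJump σ w` / `JumpDivisible σ w ℓ`
  (tri-1's criterion excluding sub-case (ii): `ℓ ∣ m`, census 6/6) and the WEAKENED hypothesis
  `InitialFormCompletableUpTo` / `F1GlobHypUpTo` (completable up to units along the stratum, tri-2 (c)) with
  `InitialFormCompletable.upTo`, `F1GlobHyp.upTo`; the failure of `F1GlobHypUpTo` is line L's honest residual.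
* §5 (F1-loc), v2 (tri-1's frame-lemma SIGNATURE `reads19/F1LocSignature.lean` 09ac42f8c130e6af, re-typed
  over the Literature notions `augmentationIdeal` / `invariantSubring` of `KiralyLutkebohmert.lean` and Mathlib's
  `SetLike.GradeZero.subring`, CITE-don't-restate): the **character cone** `charCone χ ⊆ ℤ^d` of a character
  vector `χ : Fin d → ι` (`ι` a finite additive group) with its **character lattice** `charKer χ`, and the REAL
  lattice lemmas that make the cone a legitimate fs chart monoid — `charCone_fg` (finitely generated: residue
  generators `N·e_i` and `[0,N)^d ∩ L_χ`, no Gordan lemma needed), `span_charCone_eq_charKer` (`P_χ^gp = L_χ`),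
  `charCone_saturated` (saturated INSIDE `L_χ`) and the WARNING `not_nsmulSaturated_charCone_example` (`P_χ` is in
  general NOT saturated in the ambient `ℤ^d` — Mathlib's `AddSubmonoid.NSMulSaturated`, which is what
  `LogAtlas.saturated` asks — as soon as `ι` has torsion: `ι = ZMod 2`, `χ = 1`, `2·e₀ ∈ P_χ ∌ e₀`); the degree-`0`
  invariant subring `degZeroInvariants 𝒜 σ` (`= 𝒜 0 ⊓ B^σ`, the complete local ring of the quotient `Y = V/G` at
  the image of the KILL point); the named statements `F1Loc p` (tri-1's `Statement p`, frame-explicit: at a KILL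
  point of a `μ′`-graded regular local ring the Király–Lütkebohmert invariant ring has a HOMOGENEOUS regular system
  of parameters `s` with characters `χ`, and the invariant-monomial chart of `charCone χ` into `degZeroInvariants`
  is log regular at the closed point, Kato (2.1)) and `F1LocExit p` (tri-1's `ExitShape p`, the CONSUMER shape =
  exactly the three fields `fg / saturated / span_eq_top` of `LogAtlas` plus `LogChart.IsLogRegularLocal`).
  Deviations from the posted signature, each flagged in the docstrings: (i) order `p` and KILL in the Literature
  K–L shape (`∀ b, σ^[p] b = b`, `σ ≠ refl`, `(augmentationIdeal σ).IsPrincipal`) so that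
  `KiralyLutkebohmertRegularity_holds` applies verbatim; (ii) ONE ADDED HYPOTHESIS (R-triv) "homogeneous
  elements of non-zero degree are non-units" (`ι` = characters of the INERTIA; automatic for strictly
  henselian `B` of residue characteristic `> 0`, NOT encoded by the posted binders) — WITHOUT it the posted
  `Statement p` is FALSE: explicit DVR witness in the docstring of `F1Loc` (`ι = ℤ/4`, a degree-`2` unit in the
  residue field, Kato ideal `(Z²)`); (R-triv) also yields (H-hom) `𝔪_B` homogeneous, so no (H-hom) binder.
  The docstring of `F1Loc` carries an elementary characteristic-free proof route (K–L, graded Nakayama,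
  finiteness of `A` over `A₀`, a degree walk + Krull for Kato's ideal) — `IsLogRegularLocal` is the closed-point
  condition only, so no Cohen structure theorem is needed. `F1Loc → F1LocExit` is the lattice re-presentation of
  `charCone χ` in a `ℤ`-basis of `charKer χ` (finite index in `ℤ^d`); by the WARNING it is load-bearing (not
  cosmetic) for the `LogAtlas` door of §1 — its ingredients are the three lattice lemmas of this section.
* §6 (v2.1), REAL: `finrank_charKer` (the character lattice has rank `d`), `exists_exitChart_of_charCone` (any
  closed-point-log-regular chart of a character cone, pulled back along a `ℤ`-basis `ψ : ℤ^d ≅ L_χ` of its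
  lattice, is a chart monoid `ψ⁻¹(P_χ) ⊆ ℤ^d` that is finitely generated, `NSMulSaturated` in the AMBIENT `ℤ^d` and
  spans it, with the transported chart again log regular at the closed point — same Kato ideal, unit faces in
  bijection, equal ranks) and the arrow **`f1LocExit_of_f1Loc : F1Loc p → F1LocExit p`** (with `r = d`). So the
  frame-explicit local lemma is the ONLY local input the `LogAtlas` door needs; nothing is asserted.

FILING NOTE (lead-1 g6, LEAD1-GEN6-BRIEF A4): idea-1's module v2.1 (`L/res-L1-w45c-idea-1/f1/tree/…S1aLogExitFrames.lean`,
sha16 6124855f3ff3735d, 799 lines, farm rc 0·0·0·0, tri-1 21:02:21Z PASS) exceeds the 399-line cap and is filed as THREE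
files with declarations byte-identical and in the original order: part 1 `…S1aLogExitFrames` (§1–§4), part 2
`…S1aLogExitFramesCone` (§5), part 3 `…S1aLogExitFramesExit` (§6). All three share the namespace `…S1.LogExitFrames`.
-/

set_option linter.dupNamespace false

noncomputable section

open CategoryTheory AlgebraicGeometry TopologicalSpace
open Literature.AlgebraicGeometry.Resolution

namespace Summit.ResolutionOfSingularities.ResolutionOfSingularities.Theorems.WildQuotientResolution.S1.LogExitFrames


/-! ## §1 The door: a Zariski log regular open zone is a log exit zone -/

/-- **(F1-asm), the real door.** If `Y` is regular off a closed set `Z` contained in an open `W` with `↑W`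
quasi-compact, and the open subscheme `↑W` underlies a log regular scheme for some finite fs ZARISKI atlas
(`Scheme.IsLogRegular`, Kato (2.1) at every point of every chart), then `Y` has a log exit zone in the sense of
`S1.LogExitZone` (étale atlas via `LogAtlas.toEtale`). [OURS · L1 W4.5c] -/
theorem logExitZone_of_isLogRegular (Y : Scheme.{0}) (W : Y.Opens) (Z : Set Y) (hZ : IsClosed Z)
    (hZW : Z ⊆ (W : Set Y)) [CompactSpace (W : Scheme.{0})]
    (hreg : ∀ y : Y, y ∉ Z → IsRegularLocalRing (Y.presheaf.stalk y))
    (hW : Scheme.IsLogRegular (W : Scheme.{0})) : LogExitZone Y :=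
  ⟨W, Z, hZ, hZW, inferInstance, hreg, hW.isLogRegularEtale⟩

/-- The same door with the atlas explicit: a log regular Zariski atlas `𝒜` on `↑W` (any finite index type)
gives the log exit zone. [OURS · L1 W4.5c] -/
theorem logExitZone_of_logAtlas (Y : Scheme.{0}) (W : Y.Opens) (Z : Set Y) (hZ : IsClosed Z)
    (hZW : Z ⊆ (W : Set Y)) [CompactSpace (W : Scheme.{0})]
    (hreg : ∀ y : Y, y ∉ Z → IsRegularLocalRing (Y.presheaf.stalk y))
    (𝒜 : LogAtlas.{0} (W : Scheme.{0})) (h𝒜 : 𝒜.IsLogRegular) : LogExitZone Y :=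
  logExitZone_of_isLogRegular Y W Z hZ hZW hreg h𝒜.isLogRegular_scheme

/-! ## §2 Independence modulo `𝔪²` and its descent to an invariant subring -/

section CotIndep

variable {ι : Type*} [Fintype ι]

/-- `CotIndep s`: the finite family `s : ι → R` of a local ring `R` is **independent modulo `𝔪²`**: a linear
combination `∑ cᵢ sᵢ` lies in `𝔪²` only if every coefficient lies in `𝔪` (equivalently, for `sᵢ ∈ 𝔪`: the
classes of the `sᵢ` in `𝔪/𝔪²` are linearly independent over the residue field; in a regular local ring: the
`sᵢ` are part of a regular system of parameters). [OURS · L1 W4.5c] -/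
def CotIndep {R : Type*} [CommRing R] [IsLocalRing R] (s : ι → R) : Prop :=
  ∀ c : ι → R, (∑ i, c i * s i) ∈ IsLocalRing.maximalIdeal R ^ 2 → ∀ i, c i ∈ IsLocalRing.maximalIdeal R

variable {A B : Type*} [CommRing A] [IsLocalRing A] [CommRing B] [IsLocalRing B]

/-- **Descent of independence along a local homomorphism** (the pointwise heart of (F1-glob′)): if
`f : A → B` is a local homomorphism of local rings (e.g. the inclusion `Ã = B̃^G ⊆ B̃` of Király–Lütkebohmert,
which is local because `B̃` is integral over `Ã`) and the images `f (s i)` are independent modulo `𝔪_B²`, then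
the `s i` are independent modulo `𝔪_A²` — because `f (𝔪_A²) ⊆ 𝔪_B²` and `f` reflects non-units. Used with
`s = (e, f̄_b, …)`: independence is checked in the REGULAR ring `B̃ = κ⟦e, x̄⟧`, where it is a first-order
computation, and descends to the invariant ring. [OURS · L1 W4.5c] -/
theorem CotIndep.of_map (f : A →+* B) [IsLocalHom f] (s : ι → A)
    (h : CotIndep (fun i => f (s i))) : CotIndep s := by
  intro c hc i
  have hmap : Ideal.map f (IsLocalRing.maximalIdeal A) ≤ IsLocalRing.maximalIdeal B :=
    Ideal.map_le_iff_le_comap.2 fun a ha => map_nonunit f a ha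
  have hsq : f (∑ i, c i * s i) ∈ IsLocalRing.maximalIdeal B ^ 2 := by
    have h1 : f (∑ i, c i * s i) ∈ Ideal.map f (IsLocalRing.maximalIdeal A ^ 2) :=
      Ideal.mem_map_of_mem f hc
    rw [Ideal.map_pow] at h1
    exact Ideal.pow_right_mono hmap 2 h1
  have hsum : f (∑ i, c i * s i) = ∑ i, f (c i) * f (s i) := by
    simp [map_sum, map_mul]
  rw [hsum] at hsq
  have hi := h (fun i => f (c i)) hsq i
  by_contra hci
  have hu : IsUnit (c i) := by
    simpa [IsLocalRing.mem_maximalIdeal, mem_nonunits_iff] using hci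
  exact (IsLocalRing.mem_maximalIdeal _).1 hi (hu.map f)

/-- **Perturbation along one member**: if `s` is independent modulo `𝔪²` and `t` is obtained from `s` by adding
to each member a multiple of the fixed member `s i₀` (`t i = s i + g i * s i₀`, `g i₀ = 0`), then `t` is
independent modulo `𝔪²`. Used with `s = (e, x̄_b, …)` (part of the regular system `(e, x̄)` of `B̃ = κ⟦e, x̄⟧`),
`i₀ = e` and `t = (e, f̄_b, …)` where `f̄_b = x̄_b + g_b·e` is the weighted strict transform of an invariant
with `w`-initial form `x_b` (`InitialFormCompletable`). [OURS · L1 W4.5c] -/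
theorem CotIndep.perturb {R : Type*} [CommRing R] [IsLocalRing R] [DecidableEq ι] (s t : ι → R) (i₀ : ι)
    (g : ι → R) (hg : g i₀ = 0) (ht : ∀ i, t i = s i + g i * s i₀) (hs : CotIndep s) : CotIndep t := by
  intro c hc
  -- rewrite `∑ cᵢ tᵢ` as a combination of the `sᵢ` with modified coefficient at `i₀`
  set c' : ι → R := fun i => c i + if i = i₀ then ∑ j, c j * g j else 0 with hc'
  have key : ∑ i, c' i * s i = ∑ i, c i * t i := by
    have h1 : ∑ i, c' i * s i = ∑ i, c i * s i + (∑ j, c j * g j) * s i₀ := by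
      simp only [hc', add_mul, Finset.sum_add_distrib, ite_mul, zero_mul, Finset.sum_ite_eq',
        Finset.mem_univ, if_true]
    have h2 : ∑ i, c i * t i = ∑ i, c i * s i + (∑ j, c j * g j) * s i₀ := by
      simp only [ht, mul_add, Finset.sum_add_distrib, Finset.sum_mul, mul_assoc]
    rw [h1, h2]
  have hall : ∀ i, c' i ∈ IsLocalRing.maximalIdeal R := hs c' (key ▸ hc)
  have hne : ∀ i, i ≠ i₀ → c i ∈ IsLocalRing.maximalIdeal R := by
    intro i hi
    simpa [hc', hi] using hall i
  intro i
  by_cases hi : i = i₀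
  · subst hi
    have hsum : ∑ j, c j * g j ∈ IsLocalRing.maximalIdeal R := by
      refine Ideal.sum_mem _ fun j _ => ?_
      by_cases hj : j = i
      · subst hj; simp [hg]
      · exact Ideal.mul_mem_right _ _ (hne j hj)
    have hi0 : c i + ∑ j, c j * g j ∈ IsLocalRing.maximalIdeal R := by simpa [hc'] using hall i
    simpa using Ideal.sub_mem _ hi0 hsum
  · exact hne i hi

end CotIndep

/-! ## §3 Weights: tameness and fibral strata -/

section Weights

variable {n : ℕ}

/-- **(I-T) weight tameness** for the residue characteristic `p`: no POSITIVE weight of the move is divisible by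
`p`. Engine invariant, EMPIRICAL (census: 60/60 weight vectors of record); by plan-1 RULING (2) it is an explicit
binder `(hT : WeightTame p w)` of any exit lemma that needs it, never folded into a definition. (With it the
`μ_{w_c}`-actions on the weighted blow-up charts are diagonalisable and commute with the `ℤ/p`-action.)
[OURS · L1 W4.5c] -/
def WeightTame (p : ℕ) (w : Fin n → ℕ) : Prop :=
  ∀ j, 0 < w j → ¬ p ∣ w j

/-- The move with weights `w` **has a fibral `ℓ`-stratum**: the prime `ℓ` divides two distinct positive
weights — then on the chart `x_c ≠ 0` (`ℓ ∣ w_c`) the locus `{e = 0} ∩ {x̄_j = 0 : ℓ ∤ w_j}` of points of the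
exceptional divisor with stabiliser `⊇ μ_ℓ` is positive-dimensional (it contains the `x̄_{c'}`-axis for the
second weight `w_{c'}`), so the local Király–Lütkebohmert frames must be glued ALONG it (memo §1–§2).
[OURS · L1 W4.5c] -/
def HasFibralStratumAt (w : Fin n → ℕ) (ℓ : ℕ) : Prop :=
  ∃ i j : Fin n, i ≠ j ∧ 0 < w i ∧ 0 < w j ∧ ℓ ∣ w i ∧ ℓ ∣ w j

/-- The move **has a fibral stratum** for some prime `ℓ`. [OURS · L1 W4.5c] -/
def HasFibralStratum (w : Fin n → ℕ) : Prop :=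
  ∃ ℓ : ℕ, ℓ.Prime ∧ HasFibralStratumAt w ℓ

/-- The POSITIVE weights of the move are pairwise coprime (census: 44/50 moves of record). Then every
non-trivial stabiliser stratum on the exceptional divisor is a single point per chart and (F1) is purely local
((F1-loc) + (F1-sep)). [OURS · L1 W4.5c] -/
def PosPairwiseCoprime (w : Fin n → ℕ) : Prop :=
  ∀ i j : Fin n, i ≠ j → 0 < w i → 0 < w j → Nat.Coprime (w i) (w j)

/-- **Fibral strata exist iff the positive weights are not pairwise coprime.** [OURS · L1 W4.5c] -/
theorem hasFibralStratum_iff_not_posPairwiseCoprime (w : Fin n → ℕ) :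
    HasFibralStratum w ↔ ¬ PosPairwiseCoprime w := by
  constructor
  · rintro ⟨ℓ, hℓ, i, j, hij, hi, hj, hℓi, hℓj⟩ hcop
    exact Nat.not_coprime_of_dvd_of_dvd hℓ.one_lt hℓi hℓj (hcop i j hij hi hj)
  · intro h
    simp only [PosPairwiseCoprime, not_forall] at h
    obtain ⟨i, j, hij, hi, hj, hcop⟩ := h
    obtain ⟨ℓ, hℓ, hℓdvd⟩ := Nat.exists_prime_and_dvd hcop
    exact ⟨ℓ, hℓ, i, j, hij, hi, hj, hℓdvd.trans (Nat.gcd_dvd_left _ _),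
      hℓdvd.trans (Nat.gcd_dvd_right _ _)⟩

/-- Census anchor (idea-2 `cardP_g13`, move `N-J4sq`, `p = 5`): the weights `(3, 4, 2, 0)` have the fibral
`2`-stratum (`2 ∣ 4`, `2 ∣ 2`). [OURS · L1 W4.5c] -/
theorem hasFibralStratum_census_NJ4sq : HasFibralStratum ![3, 4, 2, 0] :=
  ⟨2, Nat.prime_two, 1, 2, by decide, by decide, by decide, by decide, by decide⟩

/-- Census anchor (move `C4-E6cusp`, `p = 7`): the weights `(15, 4, 3, 0)` have the fibral `3`-stratum.
[OURS · L1 W4.5c] -/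
theorem hasFibralStratum_census_C4E6cusp : HasFibralStratum ![15, 4, 3, 0] :=
  ⟨3, Nat.prime_three, 0, 2, by decide, by decide, by decide, by decide, by decide⟩

end Weights

/-! ## §4 The (F1-glob′) hypothesis at ring level -/

section GlobPrime

variable (κ : Type) [Field κ] {n : ℕ}

/-- `σ` **raises `w`-weights strictly**: `σ(x_i) − x_i` has `w`-order `> w_i` for every coordinate. Then `σ`
preserves the `w`-filtration `I_m = {ord_w ≥ m}`, acts trivially on `gr_w`, and extends to the extended Rees
algebra `⊕ I_m T^{-m}… ` FIXING `T`: the weighted blow-up is `G`-equivariant with `G` commuting with the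
grading (memo §3, mechanism of (F1-glob′)). All admissible moves of the engine have this property (it is
the typed content of "admissible centre"). [OURS · L1 W4.5c] -/
def RaisesWeights (σ : MvPowerSeries (Fin n) κ ≃ₐ[κ] MvPowerSeries (Fin n) κ) (w : Fin n → ℕ) : Prop :=
  ∀ i, ((w i : ℕ) : ℕ∞) < MvPowerSeries.weightedOrder w (σ (MvPowerSeries.X i) - MvPowerSeries.X i)

/-- The coordinate `x_b` is **completable to an invariant `w`-initial form**: some `σ`-invariant series `f`
has `f − x_b` of `w`-order `> w_b`, i.e. `in_w(f) = x_b`. Its weighted strict transform `f̄_b = f·T^{w_b}` is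
then a GLOBAL `G`-invariant section of `𝒪(−w_b E)` on the blow-up whose restriction to every chart is
`x̄_b + (multiple of e)` — the global adapted boundary component through the `x_b`-stratum (memo §3
(F1-glob′)). [OURS · L1 W4.5c] -/
def InitialFormCompletable (σ : MvPowerSeries (Fin n) κ ≃ₐ[κ] MvPowerSeries (Fin n) κ) (w : Fin n → ℕ)
    (b : Fin n) : Prop :=
  ∃ f : MvPowerSeries (Fin n) κ, σ f = f ∧
    ((w b : ℕ) : ℕ∞) < MvPowerSeries.weightedOrder w (f - MvPowerSeries.X b)

/-- An INVARIANT coordinate is completable (`f = x_b`): this discharges (F1-glob′) on all six fibral moves of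
the census, whose needed boundary coordinate is `σ`-fixed (`N-J4sq`, `N2-nest`, `N3-nest5`: `x₁`;
`C-cusp-tri2`, `C4-E6cusp`: `x₂`; `C2-cusp-mov`: `x₃`). [OURS · L1 W4.5c] -/
theorem initialFormCompletable_of_fixed (σ : MvPowerSeries (Fin n) κ ≃ₐ[κ] MvPowerSeries (Fin n) κ)
    (w : Fin n → ℕ) (b : Fin n) (h : σ (MvPowerSeries.X b) = MvPowerSeries.X b) :
    InitialFormCompletable κ σ w b :=
  ⟨MvPowerSeries.X b, h, by simp⟩

/-- **(F1-glob′) hypothesis** for the move `(σ, w)`: along every fibral `ℓ`-stratum, every positive-weight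
coordinate of non-trivial `μ_ℓ`-character (`ℓ ∤ w_b`) is completable to an invariant `w`-initial form. Under it
the divisor `D = q(E) ∪ ⋃_b div(f̄_b)` is a homogeneous adapted frame at every KILL point of the fibral strata
(memo §3; pointwise by `CotIndep.perturb` + `CotIndep.of_map`). The residual sub-case (ii) of the memo is
exactly its failure (the needed `x_b` is a generic augmentation coordinate). [OURS · L1 W4.5c] -/
def F1GlobHyp (σ : MvPowerSeries (Fin n) κ ≃ₐ[κ] MvPowerSeries (Fin n) κ) (w : Fin n → ℕ) : Prop :=
  ∀ ℓ : ℕ, ℓ.Prime → HasFibralStratumAt w ℓ →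
    ∀ b : Fin n, 0 < w b → ¬ ℓ ∣ w b → InitialFormCompletable κ σ w b

/-- (F1-glob′) is vacuous for moves without fibral strata (pairwise coprime positive weights: 44/50 moves of
the census). [OURS · L1 W4.5c] -/
theorem f1GlobHyp_of_posPairwiseCoprime (σ : MvPowerSeries (Fin n) κ ≃ₐ[κ] MvPowerSeries (Fin n) κ)
    (w : Fin n → ℕ) (h : PosPairwiseCoprime w) : F1GlobHyp κ σ w := by
  intro ℓ hℓ hfib
  exact absurd h ((hasFibralStratum_iff_not_posPairwiseCoprime w).1 ⟨ℓ, hℓ, hfib⟩)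

/-- (F1-glob′) holds as soon as every coordinate it asks for is `σ`-invariant (the 6/6 fibral census moves).
[OURS · L1 W4.5c] -/
theorem f1GlobHyp_of_fixed (σ : MvPowerSeries (Fin n) κ ≃ₐ[κ] MvPowerSeries (Fin n) κ) (w : Fin n → ℕ)
    (h : ∀ (ℓ : ℕ) (b : Fin n), ℓ.Prime → HasFibralStratumAt w ℓ → 0 < w b → ¬ ℓ ∣ w b →
      σ (MvPowerSeries.X b) = MvPowerSeries.X b) :
    F1GlobHyp κ σ w :=
  fun ℓ hℓ hfib b hb hℓb => initialFormCompletable_of_fixed κ σ w b (h ℓ b hℓ hfib hb hℓb)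

/-! ### The weighted jump of the move and the weakened hypothesis (tri-1 Q2/Q3, tri-2 Q1 of 2026-08-27) -/

/-- The **weighted jump** `m(σ, w) = min_j (ord_w(σ x_j − x_j) − w_j) ∈ ℕ∞` of the move (`⊤` iff `σ = 1`;
`RaisesWeights σ w ↔ 0 < m`). tri-1's STRUCTURAL CRITERION (file `L/res-L1-w45c-tri-1/analysis_g5/f1q2/
Q2Q3_answer.md` dea2fd97c9a980e3, engine `fibral_kill.py`; AI-level, OURS): `σ̃` commutes with `μ_{w_c}` on every
chart, so at a KILL point of a fibral `ℓ`-curve `C` whose principal augmentation ideal is generated by `e^m` the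
augmentation coordinate `a` satisfies `w_a + m ≡ 0 (mod ℓ)` (general form: `−w_a ≡ char(π) (mod ℓ)` for a
homogeneous generator `π`). Hence `ℓ ∣ m` forces every augmentation coordinate along `C` to have TRIVIAL
character — sub-case (ii) of the memo is then impossible. Census: `(m, ℓ) = (2,2), (3,3), (3,3), (6,2), (6,3),
(12,3)`, `ℓ ∣ m` in 6/6; KILL at every closed point of `C` in 12/12 fibral charts. [OURS · L1 W4.5c] -/
def weightedJump (σ : MvPowerSeries (Fin n) κ ≃ₐ[κ] MvPowerSeries (Fin n) κ) (w : Fin n → ℕ) : ℕ∞ :=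
  ⨅ j : Fin n, (MvPowerSeries.weightedOrder w (σ (MvPowerSeries.X j) - MvPowerSeries.X j) - (w j : ℕ∞))

/-- `JumpDivisible σ w ℓ`: the weighted jump is a finite number divisible by `ℓ` — tri-1's sufficient condition
excluding sub-case (ii) along every fibral `ℓ`-stratum (the census column "m mod ℓ"; whether the min-vertex LP
forces it is OPEN). [OURS · L1 W4.5c] -/
def JumpDivisible (σ : MvPowerSeries (Fin n) κ ≃ₐ[κ] MvPowerSeries (Fin n) κ) (w : Fin n → ℕ) (ℓ : ℕ) :
    Prop :=
  ∃ m : ℕ, weightedJump κ σ w = m ∧ ℓ ∣ m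

/-- The coordinate `x_b` is **completable up to `J`-units**: some `σ`-invariant `f` has `w`-initial form
`x_b · x^d` with the monomial `x^d` supported on the coordinate set `J`. With
`J = {j ≠ b : ℓ ∣ w_j, 0 < w_j}` — the homogeneous coordinates of the fibre curve `C` of the fibral `ℓ`-stratum
`S`, generically units along `S` INCLUDING over the node (weight-`0` centre coordinates are EXCLUDED: they vanish
on the fibre over the node, tri-2 R-J 2026-08-27T20:25:37Z) — the weighted strict transform of `f` is a global
invariant divisor with local equation `x̄_b·x̄^d + e·(…)`, an adapted frame member through `S` on the OPEN part
`S° = S ∩ {x̄^d ≠ 0}`; the complement `S ∖ S°` is (finitely many vertex points of `C`) × (centre), finite over the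
centre, left to (F1-sep). This is tri-2's weakening (bus 2026-08-27T20:16:51Z (c)): the frame along `S°` needs SOME
`G`-stable divisor with non-zero `dx̄_b`-component, not the bare `x_b`. [OURS · L1 W4.5c] -/
def InitialFormCompletableUpTo (σ : MvPowerSeries (Fin n) κ ≃ₐ[κ] MvPowerSeries (Fin n) κ) (w : Fin n → ℕ)
    (b : Fin n) (J : Set (Fin n)) : Prop :=
  ∃ f : MvPowerSeries (Fin n) κ, σ f = f ∧ ∃ d : Fin n →₀ ℕ, (∀ j ∈ d.support, j ∈ J) ∧
    ((w b + Finsupp.weight w d : ℕ) : ℕ∞) <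
      MvPowerSeries.weightedOrder w (f - MvPowerSeries.X b * MvPowerSeries.monomial d (1 : κ))

/-- Literal completability implies completability up to `J`-units for every `J` (`d = 0`). [OURS · L1 W4.5c] -/
theorem InitialFormCompletable.upTo {σ : MvPowerSeries (Fin n) κ ≃ₐ[κ] MvPowerSeries (Fin n) κ}
    {w : Fin n → ℕ} {b : Fin n} (h : InitialFormCompletable κ σ w b) (J : Set (Fin n)) :
    InitialFormCompletableUpTo κ σ w b J := by
  obtain ⟨f, hf, hlt⟩ := h
  refine ⟨f, hf, 0, by simp, ?_⟩
  simpa [MvPowerSeries.monomial_zero_one] using hlt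

/-- **(F1-glob″), the weakened hypothesis** (tri-2 (c)): along every fibral `ℓ`-stratum every positive-weight
coordinate `x_b` of non-trivial character is completable up to units in the POSITIVE-weight coordinates
`{j ≠ b : ℓ ∣ w_j, 0 < w_j}` (tri-2 R-J: weight-0 centre coordinates excluded).
STATUS (AI-level): satisfied on the 6/6 fibral census moves (literal version, invariant coordinates); the literal
version FAILS at tri-2's test node `σ = (x₁, x₂ + x₁⁴, x₃, x₄ + x₁x₃)`, `w = (1,3,2,2)`, `ℓ = 2`, `x_b = x₂`
(Weierstrass: no `σ`-stable divisor through the node is transversal to `x₂`), where the weakened version is OPEN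
(a next-order equation `δ₁(F_{w₀}) = u₁·F_{w₀}`; Q1 → idea-2's engine on this node and the g12/g13 families).
Its failure is line L's HONEST RESIDUAL of (γ′), with exits (M-α)/(M-β)/(F2) (memo §3). [OURS · L1 W4.5c] -/
def F1GlobHypUpTo (σ : MvPowerSeries (Fin n) κ ≃ₐ[κ] MvPowerSeries (Fin n) κ) (w : Fin n → ℕ) : Prop :=
  ∀ ℓ : ℕ, ℓ.Prime → HasFibralStratumAt w ℓ →
    ∀ b : Fin n, 0 < w b → ¬ ℓ ∣ w b → InitialFormCompletableUpTo κ σ w b {j | j ≠ b ∧ ℓ ∣ w j ∧ 0 < w j}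

/-- (F1-glob′) implies (F1-glob″). [OURS · L1 W4.5c] -/
theorem F1GlobHyp.upTo {σ : MvPowerSeries (Fin n) κ ≃ₐ[κ] MvPowerSeries (Fin n) κ} {w : Fin n → ℕ}
    (h : F1GlobHyp κ σ w) : F1GlobHypUpTo κ σ w :=
  fun ℓ hℓ hfib b hb hℓb => (h ℓ hℓ hfib b hb hℓb).upTo κ _

end GlobPrime

end Summit.ResolutionOfSingularities.ResolutionOfSingularities.Theorems.WildQuotientResolution.S1.LogExitFrames

end
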